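import Mathlib
import Summits.NavierStokesRegularity.NavierStokesRegularity.Theorems.RootDecompLitSliceClockFiveEighths
import HarnessLib

/-!
# Route RootDecompLitSlice — cell Uᶜ `CritTameScarIsCritical` (stmt-NavierStokesRegularity-31733):
# the (5/8)-clock gives STRICTLY SUB-CRITICAL scars, hence (with parabolic concentration) NO clock
# exponent `b ≥ 5/8`

Helper toward the Tao-vacuous cell Uᶜ (`--supports 31733`; no item, no node, no registered stub).
Companion of `Theorems.RootDecompLitSliceClockFiveEighths` (the (5/8)-clock sub-cell is closed,
scar order exactly `1`). The one-step bookkeeping at `b = 5/8` has slack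
(`a' = 1.00289` at the real optimum); the integer scales `r = s¹⁹⁹⁵`, window `τ = s³²⁰⁰`, cutoff
radius `ρ = s⁴⁴¹` (base law `∫_{B_{3ρ}}|u(T)|² ≤ C ρ^{20/21} = C s⁴²⁰`, clock level `H = K s²⁰⁰⁰`)
make every term of the landed uniform scar law `LocalEnergyBudget.scar_le_uniform`
`≤ const · s^k`, `k ∈ {2000, 2000, 2790, 3528, 2214, 2004, 3528}` (window level, release cross
term, release level, Laplacian, cubic flux, pressure flux, mean part), i.e.
`∫_{B_r}|u(T)|² ≤ M s²⁰⁰⁰ = M r^{400/399}` — a uniform scar law of order `α = 400/399 > 1`.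

* ★ `ClockThreshold.uniformScarStrict_of_clock_fiveEighths` — on the classical Leray–Hopf frame with
  the (5/8)-clock: `∃ M r₁ > 0, ∀ x₀, ∀ r < r₁, ∫_{B(x₀,r)}|u(T)|² ≤ M r^{400/399}`;
* `ClockThreshold.clock_of_clock_le` — a `b`-clock is a `b'`-clock for `b' ≤ b` (`T − t ≤ 1`);
* ★ `ClockThreshold.noClockFromFiveEighths_of_concentration` — parabolic energy concentration near
  `T` (the Kang–Miura–Tsai 2021 Thm 1.6(i) / Bradshaw–Tsai 2020 shape, as in the tree endgame
  `ClockRigidity.false_of_concentration_of_uniformScar_of_clock`) EXCLUDES every clock of exponent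
  `b ≥ 5/8` — sharpens the tree's `ClockRigidity.noClockAboveTwoThirds_of_concentration`
  (`b > 2/3`);
* ★ `ClockThreshold.clockExponent_lt_fiveEighths_of_concentration` — on U's maximal-smooth frame:
  concentration ⟹ every clock exponent is `< 5/8` (tree: `≤ 2/3`,
  `ClockRigidity.clockExponent_le_twoThirds_of_concentration`).

HONEST FRAMING: helper lemmas INSIDE the Tao-vacuous cell Uᶜ; zero load of the route moves
(ROOT ⟺ U ∧ P1); no item is re-typed; the concentration hypothesis is NOT discharged here (in print
it holds at every first blow-up time: Kang–Miura–Tsai 2021 Thm 1.6(i); its typed fact and the frame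
bridge are the typist lane). Together with the closed (5/8)-cell: under concentration a first
blow-up of the √-clock class has clock exponent in `[1/2, 5/8)`. Rung 0: nothing here proves NS
regularity.
Decomp-ns route-writer g40. [cite: CaffarelliKohnNirenberg1982, §2 eq. (2.4)]
-/

set_option linter.dupNamespace false

noncomputable section

namespace Summit.NavierStokesRegularity.NavierStokesRegularity.Theorems

open MeasureTheory TopologicalSpace Set Function Filter Metric
open _root_.Topology
open scoped Laplacian InnerProductSpace RealInnerProductSpace ENNReal NNReal ContDiff
open Literature.Analysis.FluidPDE

namespace ClockThreshold

set_option maxHeartbeats 1600000 in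
/-- ★ **Uniform STRICTLY sub-critical scars on the (5/8)-clock.** Frame: `ν > 0`, classical on
`[0,T) × ℝ³`, Leray–Hopf on `[0,T]` from decaying data, and the (5/8)-clock
`‖u(t) − u(T)‖₂² ≤ K (T−t)^{5/8}` near `T`. Then `∫_{B(x₀,r)}|u(T)|² ≤ M r^{400/399}` for all
centres `x₀` and all `r < r₁` — ONE bootstrap step (uniform scar law
`LocalEnergyBudget.scar_le_uniform` at the scales `r = s¹⁹⁹⁵, τ = s³²⁰⁰, ρ = s⁴⁴¹`) from the base
law `ClockScarLaw.uniformClockScarRung` (`α₀ = 20/21`).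
[cite: CaffarelliKohnNirenberg1982, §2 eq. (2.4)] -/
theorem uniformScarStrict_of_clock_fiveEighths :
    ∀ (ν T : ℝ), 0 < ν → 0 < T →
    ∀ (u : ℝ → EuclideanSpace ℝ (Fin 3) → EuclideanSpace ℝ (Fin 3))
      (p : ℝ → EuclideanSpace ℝ (Fin 3) → ℝ),
      IsClassicalNSSolutionOn (Set.Ico 0 T) ν 0 u p →
      IsLerayHopfOn T ν 0 (u 0) u →
      HasRapidSpatialDecay (u 0) →
      (∃ K T₁ : ℝ, T₁ < T ∧ ∀ t ∈ Set.Ioo T₁ T,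
        ∫⁻ x, ‖u t x - u T x‖ₑ ^ 2 ≤ ENNReal.ofReal (K * (T - t) ^ (5 / 8 : ℝ))) →
      ∃ M r₁ : ℝ, 0 < r₁ ∧ ∀ (x₀ : EuclideanSpace ℝ (Fin 3)), ∀ r ∈ Set.Ioo 0 r₁,
        ∫ x in ball x₀ r, ‖u T x‖ ^ 2 ≤ M * r ^ (400 / 399 : ℝ) := by
  intro ν T hν hT u p hcl hLH hdec hclock
  -- the base law `α₀ = 20/21`
  obtain ⟨C₁, R₁, hR₁, hbase⟩ := ClockScarLaw.uniformClockScarRung (b := 5 / 8) (by norm_num)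
    (by norm_num) ν T hν hT u p hcl hLH hdec hclock
  obtain ⟨K, T₁, hT₁, hK⟩ := hclock
  obtain ⟨c₀, K₀, K₁, hc₀, hK₀, hK₁, hU⟩ := LocalEnergyBudget.scar_le_uniform
  obtain ⟨Cg, CL, hCg, hCL, hcut⟩ := exists_centredCutoff
  set K' : ℝ := max K 0 with hK'def
  have hK'0 : 0 ≤ K' := le_max_right _ _
  set C₁' : ℝ := max C₁ 0 with hC₁'def
  have hC₁'0 : 0 ≤ C₁' := le_max_right _ _
  set E : ℝ := ∫ x, ‖u 0 x‖ ^ 2 with hEdef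
  have hE0 : 0 ≤ E := integral_nonneg fun x => by positivity
  set D : ℝ := 2 * K' + 2 * (C₁' * (3 : ℝ) ^ (20 / 21 : ℝ)) with hDdef
  have hD0 : 0 ≤ D := by positivity
  set Gc : ℝ := Real.sqrt E * Real.sqrt K' / ν with hGcdef
  have hGc0 : 0 ≤ Gc := by positivity
  set M : ℝ := 2 * K' + 32 * K' / ν + 32 * Real.sqrt K' * Real.sqrt D / ν + 8 * CL * D +
    8 * Cg * K₀ / ν * D ^ (3 / 4 : ℝ) * Gc ^ (3 / 4 : ℝ) +
    16 * Cg * K₁ * Real.sqrt E / ν * D ^ (1 / 4 : ℝ) * Gc ^ (3 / 4 : ℝ) + c₀ * (K' + C₁') with hMdef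
  -- the admissible scale `s₁`
  set s₁ : ℝ := min (1 / 4) (min (R₁ / 3) (min (T - T₁) T)) with hs₁def
  have hs₁0 : 0 < s₁ := lt_min (by norm_num) (lt_min (by positivity) (lt_min (sub_pos.2 hT₁) hT))
  have hs₁4 : s₁ ≤ 1 / 4 := min_le_left _ _
  have hs₁R : s₁ ≤ R₁ / 3 := (min_le_right _ _).trans (min_le_left _ _)
  have hs₁T₁ : s₁ ≤ T - T₁ := (min_le_right _ _).trans ((min_le_right _ _).trans (min_le_left _ _))
  have hs₁T : s₁ ≤ T := (min_le_right _ _).trans ((min_le_right _ _).trans (min_le_right _ _))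
  refine ⟨M, s₁ ^ 1995, by positivity, fun x₀ r hr => ?_⟩
  have hr0 : 0 < r := hr.1
  -- the basic scale `s = r^{1/1995}`
  set s : ℝ := r ^ (1 / 1995 : ℝ) with hsdef
  have hs0 : 0 < s := Real.rpow_pos_of_pos hr0 _
  have hsp : ∀ (n m : ℕ) (e : ℝ), (n : ℝ) * e = m → (s ^ n) ^ e = s ^ m := by
    intro n m e h
    rw [← Real.rpow_natCast s n, ← Real.rpow_mul hs0.le, h, Real.rpow_natCast]
  have hs1995 : s ^ 1995 = r := by
    rw [hsdef, ← Real.rpow_natCast, ← Real.rpow_mul hr0.le]; norm_num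
  have hss₁ : s < s₁ := by
    have h1 : r ^ (1 / 1995 : ℝ) < (s₁ ^ 1995) ^ (1 / 1995 : ℝ) :=
      Real.rpow_lt_rpow hr0.le hr.2 (by norm_num)
    rwa [← Real.rpow_natCast s₁ 1995, ← Real.rpow_mul hs₁0.le,
      show ((1995 : ℕ) : ℝ) * (1 / 1995 : ℝ) = 1 by norm_num, Real.rpow_one] at h1
  have hs4 : s ≤ 1 / 4 := hss₁.le.trans hs₁4
  have hs1 : s ≤ 1 := hs4.trans (by norm_num)
  have hsle : ∀ {n m : ℕ}, m ≤ n → s ^ n ≤ s ^ m := fun h => pow_le_pow_of_le_one hs0.le hs1 h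
  have hspow1 : ∀ {n : ℕ}, n ≠ 0 → s ^ n ≤ s := fun h => pow_le_of_le_one hs0.le hs1 h
  -- the scales
  set τ : ℝ := s ^ 3200 with hτdef
  set ρ : ℝ := s ^ 441 with hρdef
  have hτ0 : 0 < τ := by positivity
  have hρ0 : 0 < ρ := by positivity
  have hτT₁ : τ < T - T₁ := lt_of_le_of_lt (hspow1 (by norm_num)) (hss₁.trans_le hs₁T₁)
  have hτT : τ < T := lt_of_le_of_lt (hspow1 (by norm_num)) (hss₁.trans_le hs₁T)
  have hρR₁ : 3 * ρ < R₁ := by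
    have : ρ ≤ s := hspow1 (by norm_num)
    linarith [hss₁.trans_le hs₁R]
  have hρR₁' : ρ < R₁ := by linarith
  have h4r : 4 * s ^ 1995 ≤ ρ := by
    have h1 : s ^ 1554 ≤ 1 / 4 := (hspow1 (by norm_num)).trans hs4
    calc 4 * s ^ 1995 = s ^ 441 * (4 * s ^ 1554) := by ring
      _ ≤ s ^ 441 * 1 := mul_le_mul_of_nonneg_left (by linarith) (pow_pos hs0 441).le
      _ = ρ := by rw [hρdef, mul_one]
  -- the clock level on the window
  set H : ℝ := K' * s ^ 2000 with hHdef
  have hH0 : 0 ≤ H := by positivity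
  have hmod : ∀ t ∈ Set.Ico (T - τ) T, ∫⁻ x, ‖u t x - u T x‖ₑ ^ 2 ≤ ENNReal.ofReal H := by
    intro t ht
    have htT₁ : T₁ < t := by linarith [ht.1]
    have h0t : 0 ≤ T - t := by linarith [ht.2]
    refine (hK t ⟨htT₁, ht.2⟩).trans (ENNReal.ofReal_le_ofReal ?_)
    have h1 : (T - t) ^ (5 / 8 : ℝ) ≤ τ ^ (5 / 8 : ℝ) :=
      Real.rpow_le_rpow h0t (by linarith [ht.1]) (by norm_num)
    have h2 : τ ^ (5 / 8 : ℝ) = s ^ 2000 := hsp 3200 2000 _ (by norm_num)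
    calc K * (T - t) ^ (5 / 8 : ℝ) ≤ K' * (T - t) ^ (5 / 8 : ℝ) :=
          mul_le_mul_of_nonneg_right (le_max_left _ _) (Real.rpow_nonneg h0t _)
      _ ≤ K' * τ ^ (5 / 8 : ℝ) := mul_le_mul_of_nonneg_left h1 hK'0
      _ = H := by rw [h2]
  -- the cutoff
  obtain ⟨φ, hφ, hφc, hφ0, hφ1, hone, hsupp, hDφ, hΔφ⟩ := hcut x₀ ρ hρ0
  -- THE UNIFORM SCAR LAW at these scales
  have hINEQ := hU ν T hν hT u p hcl hLH hdec x₀ (s ^ 1995) ρ (3 * ρ) τ H (by positivity) h4r hτ0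
    hτT hH0 hmod φ (Cg / ρ) (CL / ρ ^ 2) hφ hφc hφ0 hφ1 hone hsupp hDφ hΔφ (by positivity)
  -- the base law at `3ρ` and at `ρ`
  set m3 : ℝ := ∫ x in ball x₀ (3 * ρ), ‖u T x‖ ^ 2 with hm3
  set mρ : ℝ := ∫ x in ball x₀ ρ, ‖u T x‖ ^ 2 with hmρ
  have hm3_0 : 0 ≤ m3 := integral_nonneg fun x => by positivity
  have hmρ_0 : 0 ≤ mρ := integral_nonneg fun x => by positivity
  have hexp : (4 * (5 / 8 : ℝ) / (5 / 8 + 2)) = 20 / 21 := by norm_num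
  have hρpow : ρ ^ (20 / 21 : ℝ) = s ^ 420 := hsp 441 420 _ (by norm_num)
  have hm3le : m3 ≤ C₁' * (3 : ℝ) ^ (20 / 21 : ℝ) * s ^ 420 := by
    have h1 := hbase x₀ (3 * ρ) ⟨by positivity, hρR₁⟩
    rw [hexp, Real.mul_rpow (by norm_num) hρ0.le, hρpow] at h1
    refine h1.trans ?_
    have : C₁ * ((3 : ℝ) ^ (20 / 21 : ℝ) * s ^ 420) ≤ C₁' * ((3 : ℝ) ^ (20 / 21 : ℝ) * s ^ 420) :=
      mul_le_mul_of_nonneg_right (le_max_left _ _) (by positivity)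
    linarith
  have hmρle : mρ ≤ C₁' * s ^ 420 := by
    have h1 := hbase x₀ ρ ⟨hρ0, hρR₁'⟩
    rw [hexp, hρpow] at h1
    exact h1.trans (mul_le_mul_of_nonneg_right (le_max_left _ _) (by positivity))
  -- the window quantities
  have hsqrtH : Real.sqrt H = Real.sqrt K' * s ^ 1000 := by
    rw [hHdef, show s ^ 2000 = (s ^ 1000) ^ 2 by ring, Real.sqrt_mul' _ (sq_nonneg _),
      Real.sqrt_sq (by positivity)]
  have hp2000_420 : s ^ 2000 ≤ s ^ 420 := hsle (by norm_num)
  have hHle : H ≤ K' * s ^ 420 := by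
    rw [hHdef]; exact mul_le_mul_of_nonneg_left hp2000_420 hK'0
  have h2Hm : 2 * H + 2 * m3 ≤ D * s ^ 420 := by
    calc 2 * H + 2 * m3 ≤ 2 * (K' * s ^ 420) + 2 * (C₁' * (3 : ℝ) ^ (20 / 21 : ℝ) * s ^ 420) :=
          add_le_add (by linarith) (by linarith)
      _ = D * s ^ 420 := by rw [hDdef]; ring
  set A : ℝ := (Real.sqrt H + Real.sqrt m3) ^ 2 with hAdef
  have hA0 : 0 ≤ A := sq_nonneg _
  have hAle : A ≤ D * s ^ 420 := by
    have h1 : A ≤ 2 * H + 2 * m3 := by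
      rw [hAdef]
      nlinarith [sq_nonneg (Real.sqrt H - Real.sqrt m3), Real.sq_sqrt hH0, Real.sq_sqrt hm3_0]
    exact h1.trans h2Hm
  have hA34 : A ^ (3 / 4 : ℝ) ≤ D ^ (3 / 4 : ℝ) * s ^ 315 := by
    calc A ^ (3 / 4 : ℝ) ≤ (D * s ^ 420) ^ (3 / 4 : ℝ) := Real.rpow_le_rpow hA0 hAle (by norm_num)
      _ = D ^ (3 / 4 : ℝ) * s ^ 315 := by
          rw [Real.mul_rpow hD0 (by positivity), hsp 420 315 _ (by norm_num)]
  have hA14 : A ^ (1 / 4 : ℝ) ≤ D ^ (1 / 4 : ℝ) * s ^ 105 := by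
    calc A ^ (1 / 4 : ℝ) ≤ (D * s ^ 420) ^ (1 / 4 : ℝ) := Real.rpow_le_rpow hA0 hAle (by norm_num)
      _ = D ^ (1 / 4 : ℝ) * s ^ 105 := by
          rw [Real.mul_rpow hD0 (by positivity), hsp 420 105 _ (by norm_num)]
  have hsqrt2 : Real.sqrt (2 * H + 2 * m3) ≤ Real.sqrt D * s ^ 210 := by
    calc Real.sqrt (2 * H + 2 * m3) ≤ Real.sqrt (D * (s ^ 210) ^ 2) :=
          Real.sqrt_le_sqrt (by rw [show (s ^ 210) ^ 2 = s ^ 420 by ring]; exact h2Hm)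
      _ = Real.sqrt D * s ^ 210 := by
          rw [Real.sqrt_mul' _ (sq_nonneg _), Real.sqrt_sq (by positivity)]
  have hG : Real.sqrt E * Real.sqrt H / ν = Gc * s ^ 1000 := by
    rw [hsqrtH, hGcdef]; ring
  have hG34 : (Real.sqrt E * Real.sqrt H / ν) ^ (3 / 4 : ℝ) = Gc ^ (3 / 4 : ℝ) * s ^ 750 := by
    rw [hG, Real.mul_rpow hGc0 (by positivity), hsp 1000 750 _ (by norm_num)]
  have hτ14 : τ ^ (1 / 4 : ℝ) = s ^ 800 := hsp 3200 800 _ (by norm_num)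
  have hν0 : ν ≠ 0 := hν.ne'
  have hs0' : s ≠ 0 := hs0.ne'
  -- TERM BY TERM
  -- (1) window level
  have hT1 : 2 * H = 2 * K' * s ^ 2000 := by rw [hHdef]; ring
  -- (2) release
  have hT2 : 16 * ((s ^ 1995) ^ 2 / (ν * τ)) *
      ((4 * H + 4 * Real.sqrt H * Real.sqrt (2 * H + 2 * m3)) / 2) ≤
      32 * K' / ν * s ^ 2790 + 32 * Real.sqrt K' * Real.sqrt D / ν * s ^ 2000 := by
    have e : 16 * ((s ^ 1995) ^ 2 / (ν * τ)) *
        ((4 * H + 4 * Real.sqrt H * Real.sqrt (2 * H + 2 * m3)) / 2) =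
        32 * K' / ν * s ^ 2790 +
          32 * Real.sqrt K' / ν * s ^ 1790 * Real.sqrt (2 * H + 2 * m3) := by
      rw [hsqrtH, hHdef, hτdef]
      field_simp
      ring
    rw [e]
    have h1 : 32 * Real.sqrt K' / ν * s ^ 1790 * Real.sqrt (2 * H + 2 * m3) ≤
        32 * Real.sqrt K' / ν * s ^ 1790 * (Real.sqrt D * s ^ 210) :=
      mul_le_mul_of_nonneg_left hsqrt2 (by positivity)
    have h2 : 32 * Real.sqrt K' / ν * s ^ 1790 * (Real.sqrt D * s ^ 210) =
        32 * Real.sqrt K' * Real.sqrt D / ν * s ^ 2000 := by ring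
    linarith
  -- (3) Laplacian
  have hT3 : 16 * ((s ^ 1995) ^ 2 / (ν * τ)) * ((ν * (CL / ρ ^ 2) * A * τ) / 2) ≤
      8 * CL * D * s ^ 3528 := by
    have e : 16 * ((s ^ 1995) ^ 2 / (ν * τ)) * ((ν * (CL / ρ ^ 2) * A * τ) / 2) =
        8 * CL * s ^ 3108 * A := by
      rw [hτdef, hρdef]
      field_simp
      ring
    rw [e]
    calc 8 * CL * s ^ 3108 * A ≤ 8 * CL * s ^ 3108 * (D * s ^ 420) :=
          mul_le_mul_of_nonneg_left hAle (by positivity)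
      _ = 8 * CL * D * s ^ 3528 := by ring
  -- (4) cubic flux
  have hT4 : 16 * ((s ^ 1995) ^ 2 / (ν * τ)) *
      ((Cg / ρ * (K₀ * A ^ (3 / 4 : ℝ) * (τ ^ (1 / 4 : ℝ) *
        (Real.sqrt E * Real.sqrt H / ν) ^ (3 / 4 : ℝ)))) / 2) ≤
      8 * Cg * K₀ / ν * D ^ (3 / 4 : ℝ) * Gc ^ (3 / 4 : ℝ) * s ^ 2214 := by
    rw [hτ14, hG34]
    have e : 16 * ((s ^ 1995) ^ 2 / (ν * τ)) *
        ((Cg / ρ * (K₀ * A ^ (3 / 4 : ℝ) * (s ^ 800 * (Gc ^ (3 / 4 : ℝ) * s ^ 750)))) / 2) =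
        8 * Cg * K₀ / ν * Gc ^ (3 / 4 : ℝ) * s ^ 1899 * A ^ (3 / 4 : ℝ) := by
      rw [hτdef, hρdef]
      field_simp
      try ring
    rw [e]
    calc 8 * Cg * K₀ / ν * Gc ^ (3 / 4 : ℝ) * s ^ 1899 * A ^ (3 / 4 : ℝ)
        ≤ 8 * Cg * K₀ / ν * Gc ^ (3 / 4 : ℝ) * s ^ 1899 * (D ^ (3 / 4 : ℝ) * s ^ 315) :=
          mul_le_mul_of_nonneg_left hA34 (by positivity)
      _ = 8 * Cg * K₀ / ν * D ^ (3 / 4 : ℝ) * Gc ^ (3 / 4 : ℝ) * s ^ 2214 := by ring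
  -- (5) pressure flux
  have hT5 : 16 * ((s ^ 1995) ^ 2 / (ν * τ)) *
      ((2 * (Cg / ρ) * (K₁ * Real.sqrt E * A ^ (1 / 4 : ℝ) * (τ ^ (1 / 4 : ℝ) *
        (Real.sqrt E * Real.sqrt H / ν) ^ (3 / 4 : ℝ)))) / 2) ≤
      16 * Cg * K₁ * Real.sqrt E / ν * D ^ (1 / 4 : ℝ) * Gc ^ (3 / 4 : ℝ) * s ^ 2004 := by
    rw [hτ14, hG34]
    have e : 16 * ((s ^ 1995) ^ 2 / (ν * τ)) *
        ((2 * (Cg / ρ) * (K₁ * Real.sqrt E * A ^ (1 / 4 : ℝ) *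
          (s ^ 800 * (Gc ^ (3 / 4 : ℝ) * s ^ 750)))) / 2) =
        16 * Cg * K₁ * Real.sqrt E / ν * Gc ^ (3 / 4 : ℝ) * s ^ 1899 * A ^ (1 / 4 : ℝ) := by
      rw [hτdef, hρdef]
      field_simp
      try ring
    rw [e]
    calc 16 * Cg * K₁ * Real.sqrt E / ν * Gc ^ (3 / 4 : ℝ) * s ^ 1899 * A ^ (1 / 4 : ℝ)
        ≤ 16 * Cg * K₁ * Real.sqrt E / ν * Gc ^ (3 / 4 : ℝ) * s ^ 1899 *
            (D ^ (1 / 4 : ℝ) * s ^ 105) :=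
          mul_le_mul_of_nonneg_left hA14 (by positivity)
      _ = 16 * Cg * K₁ * Real.sqrt E / ν * D ^ (1 / 4 : ℝ) * Gc ^ (3 / 4 : ℝ) * s ^ 2004 := by ring
  -- (6) mean part
  have hT6 : c₀ * (s ^ 1995 / ρ) ^ 2 * (H + mρ) ≤ c₀ * (K' + C₁') * s ^ 3528 := by
    have e : c₀ * (s ^ 1995 / ρ) ^ 2 * (H + mρ) = c₀ * s ^ 3108 * (H + mρ) := by
      rw [hρdef]
      field_simp
      try ring
    rw [e]
    have h1 : H + mρ ≤ (K' + C₁') * s ^ 420 := by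
      calc H + mρ ≤ K' * s ^ 420 + C₁' * s ^ 420 := add_le_add hHle hmρle
        _ = (K' + C₁') * s ^ 420 := by ring
    calc c₀ * s ^ 3108 * (H + mρ) ≤ c₀ * s ^ 3108 * ((K' + C₁') * s ^ 420) :=
          mul_le_mul_of_nonneg_left h1 (by positivity)
      _ = c₀ * (K' + C₁') * s ^ 3528 := by ring
  -- powers of `s` down to `s^2000`
  have hp2790 : s ^ 2790 ≤ s ^ 2000 := hsle (by norm_num)
  have hp3528 : s ^ 3528 ≤ s ^ 2000 := hsle (by norm_num)
  have hp2214 : s ^ 2214 ≤ s ^ 2000 := hsle (by norm_num)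
  have hp2004 : s ^ 2004 ≤ s ^ 2000 := hsle (by norm_num)
  -- assemble
  have hsplit : ∀ (P X Y Z W V : ℝ), P * ((X + (Y + Z + W)) / 2) + V =
      P * (X / 2) + P * (Y / 2) + P * (Z / 2) + P * (W / 2) + V := fun P X Y Z W V => by ring
  have hr400 : r ^ (400 / 399 : ℝ) = s ^ 2000 := by
    rw [← hs1995]; exact hsp 1995 2000 _ (by norm_num)
  rw [hr400, ← hs1995]
  refine hINEQ.trans ?_
  rw [add_assoc, hsplit]
  have c2 : 0 ≤ 32 * K' / ν := by positivity
  have c3 : 0 ≤ 8 * CL * D := by positivity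
  have c4 : 0 ≤ 8 * Cg * K₀ / ν * D ^ (3 / 4 : ℝ) * Gc ^ (3 / 4 : ℝ) := by positivity
  have c5 : 0 ≤ 16 * Cg * K₁ * Real.sqrt E / ν * D ^ (1 / 4 : ℝ) * Gc ^ (3 / 4 : ℝ) := by
    positivity
  have c6 : 0 ≤ c₀ * (K' + C₁') := by positivity
  have hMs : M * s ^ 2000 = 2 * K' * s ^ 2000 + ((32 * K' / ν * s ^ 2000 +
      32 * Real.sqrt K' * Real.sqrt D / ν * s ^ 2000) + 8 * CL * D * s ^ 2000 +
      8 * Cg * K₀ / ν * D ^ (3 / 4 : ℝ) * Gc ^ (3 / 4 : ℝ) * s ^ 2000 +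
      16 * Cg * K₁ * Real.sqrt E / ν * D ^ (1 / 4 : ℝ) * Gc ^ (3 / 4 : ℝ) * s ^ 2000 +
      c₀ * (K' + C₁') * s ^ 2000) := by rw [hMdef]; ring
  rw [hMs]
  gcongr ?_ + (?_ + ?_ + ?_ + ?_ + ?_)
  · exact le_of_eq hT1
  · exact hT2.trans (add_le_add (mul_le_mul_of_nonneg_left hp2790 c2) le_rfl)
  · exact hT3.trans (mul_le_mul_of_nonneg_left hp3528 c3)
  · exact hT4.trans (mul_le_mul_of_nonneg_left hp2214 c4)
  · exact hT5.trans (mul_le_mul_of_nonneg_left hp2004 c5)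
  · exact hT6.trans (mul_le_mul_of_nonneg_left hp3528 c6)

/-- A clock of exponent `b` near `T` is a clock of every exponent `b' ≤ b` near `T`
(`(T−t)^b ≤ (T−t)^{b'}` once `T − t ≤ 1`; `K ↦ max K 0`). [folklore] -/
theorem clock_of_clock_le {T b b' : ℝ} (hb : b' ≤ b)
    {u : ℝ → EuclideanSpace ℝ (Fin 3) → EuclideanSpace ℝ (Fin 3)}
    (h : ∃ K T₁ : ℝ, T₁ < T ∧ ∀ t ∈ Set.Ioo T₁ T,
      ∫⁻ x, ‖u t x - u T x‖ₑ ^ 2 ≤ ENNReal.ofReal (K * (T - t) ^ b)) :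
    ∃ K T₁ : ℝ, T₁ < T ∧ ∀ t ∈ Set.Ioo T₁ T,
      ∫⁻ x, ‖u t x - u T x‖ₑ ^ 2 ≤ ENNReal.ofReal (K * (T - t) ^ b') := by
  obtain ⟨K, T₁, hT₁, hK⟩ := h
  refine ⟨max K 0, max T₁ (T - 1), max_lt hT₁ (by linarith), fun t ht => ?_⟩
  have ht₁ : T₁ < t := lt_of_le_of_lt (le_max_left _ _) ht.1
  have ht1 : T - 1 < t := lt_of_le_of_lt (le_max_right _ _) ht.1
  have h0 : 0 < T - t := sub_pos.mpr ht.2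
  have h1 : T - t ≤ 1 := by linarith
  refine (hK t ⟨ht₁, ht.2⟩).trans (ENNReal.ofReal_le_ofReal ?_)
  have hpow : (T - t) ^ b ≤ (T - t) ^ b' := Real.rpow_le_rpow_of_exponent_ge h0 h1 hb
  calc K * (T - t) ^ b ≤ max K 0 * (T - t) ^ b :=
        mul_le_mul_of_nonneg_right (le_max_left _ _) (Real.rpow_nonneg h0.le _)
    _ ≤ max K 0 * (T - t) ^ b' := mul_le_mul_of_nonneg_left hpow (le_max_right _ _)

/-- ★ **CLOCK RIGIDITY AT 5/8 on the classical Leray–Hopf frame**: parabolic energy concentration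
near `T` (the Kang–Miura–Tsai 2021 Thm 1.6(i) shape, quantified AFTER `ν, T, u, p`) EXCLUDES every
clock of exponent `b ≥ 5/8`: such a clock is a (5/8)-clock, which forces uniform scars of order
`400/399 > 1`, and the tree endgame `ClockRigidity.false_of_concentration_of_uniformScar_of_clock`
applies (`5/8 > 1/2`). Sharpens `ClockRigidity.noClockAboveTwoThirds_of_concentration`.
[folklore] -/
theorem noClockFromFiveEighths_of_concentration {b : ℝ} (hb : 5 / 8 ≤ b) :
    ∀ (ν T : ℝ), 0 < ν → 0 < T →
    ∀ (u : ℝ → EuclideanSpace ℝ (Fin 3) → EuclideanSpace ℝ (Fin 3))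
      (p : ℝ → EuclideanSpace ℝ (Fin 3) → ℝ),
      IsClassicalNSSolutionOn (Set.Ico 0 T) ν 0 u p →
      IsLerayHopfOn T ν 0 (u 0) u →
      HasRapidSpatialDecay (u 0) →
      (∃ ε S₀ T₀ : ℝ, 0 < ε ∧ 0 < S₀ ∧ T₀ < T ∧ ∀ t ∈ Set.Ioo T₀ T,
        ∃ x : EuclideanSpace ℝ (Fin 3), ε * Real.sqrt (T - t) ≤
          ∫ y in ball x (Real.sqrt ((T - t) / S₀)), ‖u t y‖ ^ 2) →
      ¬ (∃ K T₁ : ℝ, T₁ < T ∧ ∀ t ∈ Set.Ioo T₁ T,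
        ∫⁻ x, ‖u t x - u T x‖ₑ ^ 2 ≤ ENNReal.ofReal (K * (T - t) ^ b)) := by
  intro ν T hν hT u p hcl hLH hdec hconc hclock
  have h58 := clock_of_clock_le hb hclock
  obtain ⟨M, r₁, hr₁, hM⟩ := uniformScarStrict_of_clock_fiveEighths ν T hν hT u p hcl hLH hdec h58
  exact ClockRigidity.false_of_concentration_of_uniformScar_of_clock hT u hLH.memLp
    (α := 400 / 399) (by norm_num) ⟨M, r₁, hr₁, hM⟩ (b := 5 / 8) (by norm_num) h58 hconc

/-- ★ **On U's maximal-smooth frame: under parabolic energy concentration every clock exponent of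
a first blow-up is `< 5/8`.** (Frame of U/Uᶜ/Uᵃ; the concentration hypothesis is Kang–Miura–Tsai
2021 Thm 1.6(i) read on this frame — its discharge needs the typed fact and the frame bridge.)
Sharpens `ClockRigidity.clockExponent_le_twoThirds_of_concentration` (`≤ 2/3`) and complements the
closed (5/8)-cell `ClockThreshold.fiveEighthsClockCell`. [folklore] -/
theorem clockExponent_lt_fiveEighths_of_concentration :
    ∀ (ν T : ℝ), 0 < ν → 0 < T →
    ∀ (u : ℝ → EuclideanSpace ℝ (Fin 3) → EuclideanSpace ℝ (Fin 3))
      (p : ℝ → EuclideanSpace ℝ (Fin 3) → ℝ),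
      IsMaximalSmoothSolution ν 0 u p T →
      IsLerayHopfOn T ν 0 (u 0) u →
      HasRapidSpatialDecay (u 0) →
      (∃ ε S₀ T₀ : ℝ, 0 < ε ∧ 0 < S₀ ∧ T₀ < T ∧ ∀ t ∈ Set.Ioo T₀ T,
        ∃ x : EuclideanSpace ℝ (Fin 3), ε * Real.sqrt (T - t) ≤
          ∫ y in ball x (Real.sqrt ((T - t) / S₀)), ‖u t y‖ ^ 2) →
      ∀ b : ℝ, (∃ K T₁ : ℝ, T₁ < T ∧ ∀ t ∈ Set.Ioo T₁ T,
        ∫⁻ x, ‖u t x - u T x‖ₑ ^ 2 ≤ ENNReal.ofReal (K * (T - t) ^ b)) → b < 5 / 8 := by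
  intro ν T hν hT u p hmax hLH hdec hconc b hclock
  by_contra h
  exact noClockFromFiveEighths_of_concentration (not_lt.mp h) ν T hν hT u p hmax.1 hLH hdec hconc
    hclock

end ClockThreshold

end Summit.NavierStokesRegularity.NavierStokesRegularity.Theorems

end
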